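import Mathlib
import Summits.MatrixMultiplication.MatrixMultiplication.Theorems.SoloBlindKraftDecomposition

/-!
# Solo-blind seat (MatrixMultiplication), s68 — the HYPERPLANE-CLASS step of (K₃), outside pattern (2,1)
(TRIANGLE.md (R18.4), CLAIMS c650; brief `paper/KraftK3.md` §3(c))

Let `q : G →+ ZMod 3` (a "hyperplane" `H = ker q`), and suppose exactly three terms of `h` lie outside `H`,
two on one side and one on the other: `q (h a) = q (h b) = 1`, `q (h c) = 2`.  Writing `w` for the terms inside `H`,
the decomposition identity gives `K_h(τ) = Σ_{S ⊆ {a,b,c}} 2^{-|S|} K_w(τ - h_S)`, and `K_w` vanishes off `H`, so only the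
`S` with `q(h_S) = q(τ)` survive.  The Kraft bound for `h` then follows from four TOOL inequalities, each of which is the
Kraft bound for a strictly shorter zero-sum-free sequence (available to the induction on (rank, length)):
`T1` = (K₃) for `w`; `T2`, `T3` = (K₃) for `w ∪ {h a + h c}`, `w ∪ {h b + h c}` (balanced block sums, inside `H`);
`T4` = (K₃) for `w ∪ {h a, h b}` — all written out in expanded (split) form.  Certificate: class 0 = ½·T2 + ½·T3,
class 1 = ¾·T4 + ⅛·T3(τ - h a) + ⅛·T2(τ - h b), class 2 = T1.  Together with the patterns (1,0), (2,0), (1,1) this is what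
makes (K₃) a theorem for rank ≤ 3 given the classification of indecomposable sets.  Pure finite combinatorics.
-/

set_option linter.dupNamespace false

namespace Summit.MatrixMultiplication.MatrixMultiplication.Theorems

open Finset BigOperators

/-- The three residues mod 3 (stated before the classical scope so that `decide` evaluates). -/
theorem soloBlind_zmod_three_cases (x : ZMod 3) : x = 0 ∨ x = 1 ∨ x = 2 := by
  revert x; decide

open scoped Classical

section KraftHyperplane

variable {ι : Type*} {G : Type*} [AddCommGroup G]

/-- HYPERPLANE-CLASS LEMMA, pattern (2,1): the Kraft bound for `h` on `s` from the Kraft bounds of four shorter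
sub-sum sequences (see the module docstring). -/
theorem soloBlind_kraft_pattern21 (s : Finset ι) (h : ι → G) (q : G →+ ZMod 3) (a b c : ι)
    (hab : a ≠ b) (hac : a ≠ c) (hbc : b ≠ c)
    (hu : (s.filter fun i => ¬ q (h i) = 0) = {a, b, c})
    (hqa : q (h a) = 1) (hqb : q (h b) = 1) (hqc : q (h c) = 2)
    (T1 : ∀ σ, soloBlindKraft (s.filter fun i => q (h i) = 0) h σ ≤ 1)
    (T2 : ∀ σ, soloBlindKraft (s.filter fun i => q (h i) = 0) h σ
        + (1/2 : ℚ) * soloBlindKraft (s.filter fun i => q (h i) = 0) h (σ - (h a + h c)) ≤ 1)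
    (T3 : ∀ σ, soloBlindKraft (s.filter fun i => q (h i) = 0) h σ
        + (1/2 : ℚ) * soloBlindKraft (s.filter fun i => q (h i) = 0) h (σ - (h b + h c)) ≤ 1)
    (T4 : ∀ σ, soloBlindKraft (s.filter fun i => q (h i) = 0) h σ
        + (1/2 : ℚ) * soloBlindKraft (s.filter fun i => q (h i) = 0) h (σ - h a)
        + (1/2 : ℚ) * soloBlindKraft (s.filter fun i => q (h i) = 0) h (σ - h b)
        + (1/4 : ℚ) * soloBlindKraft (s.filter fun i => q (h i) = 0) h (σ - (h a + h b)) ≤ 1)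
    (τ : G) : soloBlindKraft s h τ ≤ 1 := by
  -- the split identity, restated with the canonical decidability instances of this statement
  have key : soloBlindKraft s h τ = ∑ S ∈ (s.filter fun i => ¬ q (h i) = 0).powerset,
      (1/2 : ℚ) ^ S.card * soloBlindKraft (s.filter fun i => q (h i) = 0) h (τ - ∑ i ∈ S, h i) := by
    convert soloBlindKraft_split s h (fun i => q (h i) = 0) τ
  rw [key, hu]
  set w := s.filter fun i => q (h i) = 0 with hw_def
  have hwK : ∀ i ∈ w, h i ∈ q.ker := fun i hi => by
    rw [AddMonoidHom.mem_ker]; exact (Finset.mem_filter.mp hi).2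
  have van : ∀ σ, q σ ≠ 0 → soloBlindKraft w h σ = 0 := fun σ hσ =>
    soloBlindKraft_eq_zero_of_not_mem w h q.ker hwK (by rwa [AddMonoidHom.mem_ker])
  have nn : ∀ σ, 0 ≤ soloBlindKraft w h σ := fun σ => soloBlindKraft_nonneg w h σ
  have hnab : a ∉ ({b, c} : Finset ι) := by simp [hab, hac]
  have hnbc : b ∉ ({c} : Finset ι) := by simp [hbc]
  have hpc : ({c} : Finset ι).powerset = {∅, {c}} := by
    ext t; simp [Finset.subset_singleton_iff]
  have hne : (∅ : Finset ι) ≠ {c} := (Finset.singleton_ne_empty c).symm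
  have hac' : a ∉ ({c} : Finset ι) := by simp [hac]
  have hab' : a ∉ ({b} : Finset ι) := by simp [hab]
  simp only [Finset.sum_powerset_insert hnab, Finset.sum_powerset_insert hnbc, hpc, Finset.sum_pair hne,
    Finset.insert_empty, Finset.sum_empty, Finset.sum_singleton, Finset.card_empty, Finset.card_singleton,
    Finset.sum_insert hnbc, Finset.sum_insert hac', Finset.sum_insert hab', Finset.sum_insert hnab,
    Finset.card_insert_of_notMem hnbc, Finset.card_insert_of_notMem hac',
    Finset.card_insert_of_notMem hab', Finset.card_insert_of_notMem hnab, pow_zero, one_mul, sub_zero]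
  norm_num
  -- q-values of the eight shifted points
  have q1 : q (τ - h c) = q τ - 2 := by rw [map_sub, hqc]
  have q2 : q (τ - h b) = q τ - 1 := by rw [map_sub, hqb]
  have q3 : q (τ - (h b + h c)) = q τ - 3 := by rw [map_sub, map_add, hqb, hqc]; ring
  have q4 : q (τ - h a) = q τ - 1 := by rw [map_sub, hqa]
  have q5 : q (τ - (h a + h c)) = q τ - 3 := by rw [map_sub, map_add, hqa, hqc]; ring
  have q6 : q (τ - (h a + h b)) = q τ - 2 := by rw [map_sub, map_add, hqa, hqb]; ring
  have q7 : q (τ - (h a + (h b + h c))) = q τ - 4 := by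
    rw [map_sub, map_add, map_add, hqa, hqb, hqc]; ring
  -- the three classes of τ
  have hcases : q τ = 0 ∨ q τ = 1 ∨ q τ = 2 := soloBlind_zmod_three_cases (q τ)
  rcases hcases with h0 | h1 | h2
  · -- class 0: survivors ∅, {b,c}, {a,c}; certificate ½ T2 + ½ T3
    have z1 := van (τ - h c) (by rw [q1, h0]; decide)
    have z2 := van (τ - h b) (by rw [q2, h0]; decide)
    have z4 := van (τ - h a) (by rw [q4, h0]; decide)
    have z6 := van (τ - (h a + h b)) (by rw [q6, h0]; decide)
    have z7 := van (τ - (h a + (h b + h c))) (by rw [q7, h0]; decide)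
    have t2 := T2 τ; have t3 := T3 τ
    linarith [z1, z2, z4, z6, z7]
  · -- class 1: survivors {b}, {a}, {a,b,c}; certificate ¾ T4(τ) + ⅛ T3(τ - h a) + ⅛ T2(τ - h b)
    have z0 := van τ (by rw [h1]; decide)
    have z1 := van (τ - h c) (by rw [q1, h1]; decide)
    have z3 := van (τ - (h b + h c)) (by rw [q3, h1]; decide)
    have z5 := van (τ - (h a + h c)) (by rw [q5, h1]; decide)
    have z6 := van (τ - (h a + h b)) (by rw [q6, h1]; decide)
    have t4 := T4 τ
    have t3 := T3 (τ - h a)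
    have t2 := T2 (τ - h b)
    have e3 : τ - h a - (h b + h c) = τ - (h a + (h b + h c)) := by abel
    have e2 : τ - h b - (h a + h c) = τ - (h a + (h b + h c)) := by abel
    rw [e3] at t3; rw [e2] at t2
    have n7 := nn (τ - (h a + (h b + h c)))
    have n6 := nn (τ - (h a + h b))
    linarith [z0, z1, z3, z5, z6]
  · -- class 2: survivors {c}, {a,b}; certificate T1
    have z0 := van τ (by rw [h2]; decide)
    have z2 := van (τ - h b) (by rw [q2, h2]; decide)
    have z3 := van (τ - (h b + h c)) (by rw [q3, h2]; decide)
    have z4 := van (τ - h a) (by rw [q4, h2]; decide)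
    have z5 := van (τ - (h a + h c)) (by rw [q5, h2]; decide)
    have z7 := van (τ - (h a + (h b + h c))) (by rw [q7, h2]; decide)
    have t1 := T1 (τ - h c); have t1' := T1 (τ - (h a + h b))
    linarith [z0, z2, z3, z4, z5, z7]

end KraftHyperplane

end Summit.MatrixMultiplication.MatrixMultiplication.Theorems
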